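import Summits.QuantumFields.YangMills.Theorems.SwapVirialDeficitZeroModeSigmaFourSmallBallSlopes
import HarnessLib

/-!
# Exact zero-mode rung Z5 — the σ-TWISTED FOUR-LEADER small ball, III-b: the limit event and the pointwise limit off the level sets
# (LEAD ym-line-sfw-p2 g93 07:46Z «`Haar⁴{E_σ(t)} = v₇t⁷(1 + O(t^θ))`»; free-hands support of ⟨stmt-QuantumFields-24197⟩)

With the relation maps `M_i(s)` of part III-a (`‖M_i(s)‖ ≤ r·s` are the six relations of the blown-up σ-event at threshold `r`, `M_i(0) = 0` for
`z₀ > 0`, `M_i'(0) = L_i` explicit): the LIMIT EVENT at threshold `r` is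
`limSigma r A = {‖x̄‖ < 1, ‖ȳ‖ < 1, |z₀| < 1, z₀ > 0, ‖L_i‖ ≤ r (i < 6)}`
and ★★ `tendsto_indicator_rescaledSigmaR`: `𝟙_{rescaledSigmaR r s A}(w) → 𝟙_{limSigma r A}(w)` as `s → 0⁺` at every `w = ((x,y),z)` with
`x̄, ȳ ≠ 0`, `z₀ ≠ 0`, off the sphere pieces `‖x̄‖ = 1`, `‖ȳ‖ = 1`, `|z₀| = 1` and OFF THE LEVEL SETS `‖L_i‖ = r` — the slope `s⁻¹M_i(s) → L_i`
(✓`HasDerivAt.tendsto_slope_zero_right`) decides `‖M_i(s)‖ ≤ r s` eventually (`eventually_norm_le_mul_iff`); for `z₀ < 0` the first seam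
relation fails for small `s` (`‖M₃(0)‖ = 2`).  Part V picks `r ∈ (0, 1]` with null level sets (all but countably many, `Measure.countable_meas_level_set_pos`)
and runs dominated convergence with part IV's dominator; this file also records the measurability of `L_i` in all variables (`measurable_Lrel_hub`).
HONEST LABEL: finite-dimensional calculus on `SU(2)⁴` (plan-level zero-mode rung of the DRAFT line «sharp-sigma»); NOT the fixed-`L` sharp law,
NOT ⟨24197⟩; own crux ⟨22884⟩ OPEN (blocked-on ⟨19935⟩); the Yang–Mills mass gap is NOT proved; no summit is proved by a line.
Width seat ym-line-sfw-p2-w3 g63 (cell ym-idea-1, free hands), `--supports stmt-QuantumFields-24197`.  Standard axioms, 0 `sorry`.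
References: [cite: GonzalezarroyoAltes1988]; [cite: Vanbaal2001]; [cite: Luscher1983, §2]; [folklore].
-/

set_option autoImplicit false

noncomputable section

open MeasureTheory Quaternion Set Filter Topology
open scoped Quaternion ENNReal BigOperators RealInnerProductSpace
open Literature.MathematicalPhysics.QuantumLattice
open Literature.Analysis.Calculus (radialUnit radialUnit_def norm_radialUnit tangentialProj tangentialProj_apply)
open Summit.QuantumFields.YangMills.Theorems.SwapTwistDeficit.ToronLog
open Summit.QuantumFields.YangMills.Theorems.SwapVirialDeficit.ZeroModeGroup

attribute [local instance] Literature.Analysis.FluidPDE.Tao2016.quatMeasurableSpace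
  Literature.Analysis.FluidPDE.Tao2016.quatBorelSpace
  Literature.MathematicalPhysics.QuantumLattice.secondCountableTopology_su2

namespace Summit.QuantumFields.YangMills.Theorems.SwapVirialDeficit.ZeroModeSigma

/-! ## §27 The limit event -/

/-- ★ **The limit event at threshold `r`**: `‖x̄‖ < 1`, `‖ȳ‖ < 1`, `|z₀| < 1`, `z₀ > 0`, and `‖L_i‖ ≤ r` for the six derivatives `L_i = M_i'(0)`.
[folklore] -/
def limSigma (r : ℝ) (A : ℍ) : Set ((ℍ × ℍ) × ℍ) :=
  {w | (∀ i : Fin 6, ‖Lrel A w.1.1 w.1.2 w.2 i‖ ≤ r) ∧ (‖axPart w.1.1‖ < 1 ∧ ‖axPart w.1.2‖ < 1) ∧ ‖(w.2.re : ℍ)‖ < 1 ∧ 0 < w.2.re}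

/-- Unfolding membership in `limSigma`. [folklore] -/
theorem mem_limSigma_iff (r : ℝ) (A : ℍ) (w : (ℍ × ℍ) × ℍ) : w ∈ limSigma r A ↔
    (∀ i : Fin 6, ‖Lrel A w.1.1 w.1.2 w.2 i‖ ≤ r) ∧ (‖axPart w.1.1‖ < 1 ∧ ‖axPart w.1.2‖ < 1) ∧ ‖(w.2.re : ℍ)‖ < 1 ∧ 0 < w.2.re := Iff.rfl

/-! ## §28 Eventual decision of one relation by its slope -/

/-- ★ **A relation is eventually decided by its slope**: if `s⁻¹·M(s) → L` as `s → 0⁺` and `‖L‖ ≠ r`, then for all small `s > 0`,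
`‖M(s)‖ ≤ r·s ↔ ‖L‖ ≤ r`. [folklore] -/
theorem eventually_norm_le_mul_iff {M : ℝ → ℍ} {L : ℍ} {r : ℝ} (hM : Tendsto (fun s => s⁻¹ • M s) (𝓝[>] (0:ℝ)) (𝓝 L)) (hr : ‖L‖ ≠ r) :
    ∀ᶠ s in 𝓝[>] (0:ℝ), (‖M s‖ ≤ r * s ↔ ‖L‖ ≤ r) := by
  have hn : Tendsto (fun s => ‖s⁻¹ • M s‖) (𝓝[>] (0:ℝ)) (𝓝 ‖L‖) := hM.norm
  have hpos : ∀ᶠ s in 𝓝[>] (0:ℝ), 0 < s := self_mem_nhdsWithin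
  have key : ∀ s : ℝ, 0 < s → (‖M s‖ ≤ r * s ↔ ‖s⁻¹ • M s‖ ≤ r) := by
    intro s hs
    rw [norm_smul, norm_inv, Real.norm_eq_abs, abs_of_pos hs, inv_mul_le_iff₀ hs, mul_comm]
  rcases lt_or_gt_of_ne hr with hlt | hgt
  · filter_upwards [hpos, hn.eventually (gt_mem_nhds hlt)] with s hs h
    rw [key s hs]
    exact ⟨fun _ => hlt.le, fun _ => h.le⟩
  · filter_upwards [hpos, hn.eventually (lt_mem_nhds hgt)] with s hs h
    rw [key s hs]
    exact ⟨fun h1 => absurd (lt_of_lt_of_le h h1) (lt_irrefl _), fun h1 => absurd (lt_of_lt_of_le hgt h1) (lt_irrefl _)⟩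

/-- The slope of a relation map at `0`: `s⁻¹·M_i(s) → L_i` (`x̄, ȳ ≠ 0`, `z₀ > 0`, axial unit hub). [folklore] -/
theorem tendsto_slope_Mrel {A : ℍ} (hA : ‖A‖ = 1) (hJ : A.imJ = 0) (hK : A.imK = 0) {x y z : ℍ} (hx : axPart x ≠ 0) (hy : axPart y ≠ 0)
    (hz : 0 < z.re) (i : Fin 6) : Tendsto (fun s => s⁻¹ • Mrel A x y z i s) (𝓝[>] (0:ℝ)) (𝓝 (Lrel A x y z i)) := by
  have h := (hasDerivAt_Mrel A hx hy hz.ne' i).tendsto_slope_zero_right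
  simp only [zero_add, Mrel_zero_of_pos hA hJ hK x y hz i, sub_zero] at h
  exact h

/-! ## §29 The pointwise limit off the level sets -/

/-- The norm of a dilated pair letter is continuous in the scale. [folklore] -/
theorem continuous_norm_dilate_param (x : ℍ) : Continuous fun s : ℝ => ‖axPart x + s • trPart x‖ := by fun_prop

/-- The norm of the dilated slaved letter is continuous in the scale. [folklore] -/
theorem continuous_norm_dilateIm_param (z : ℍ) : Continuous fun s : ℝ => ‖(z.re : ℍ) + s • z.im‖ := by fun_prop

/-- ★★ **THE POINTWISE LIMIT (case `z₀ > 0`)**: off the level sets `‖L_i‖ = r` and the sphere pieces, the rescaled event at threshold `r` is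
eventually decided by the limit event. [folklore] -/
theorem mem_rescaledSigmaR_eventually_iff {r : ℝ} {A : ℍ} (hA : ‖A‖ = 1) (hJ : A.imJ = 0) (hK : A.imK = 0) {w : (ℍ × ℍ) × ℍ}
    (hx : axPart w.1.1 ≠ 0) (hy : axPart w.1.2 ≠ 0) (hz : 0 < w.2.re)
    (hbx : ‖axPart w.1.1‖ ≠ 1) (hby : ‖axPart w.1.2‖ ≠ 1) (hbz : ‖(w.2.re : ℍ)‖ ≠ 1)
    (hL : ∀ i : Fin 6, ‖Lrel A w.1.1 w.1.2 w.2 i‖ ≠ r) :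
    ∀ᶠ s in 𝓝[>] (0:ℝ), (w ∈ rescaledSigmaR r s A ↔ w ∈ limSigma r A) := by
  -- the six relations
  have hrel : ∀ i : Fin 6, ∀ᶠ s in 𝓝[>] (0:ℝ), (‖Mrel A w.1.1 w.1.2 w.2 i s‖ ≤ r * s ↔ ‖Lrel A w.1.1 w.1.2 w.2 i‖ ≤ r) := fun i =>
    eventually_norm_le_mul_iff (tendsto_slope_Mrel hA hJ hK hx hy hz i) (hL i)
  have hall : ∀ᶠ s in 𝓝[>] (0:ℝ), ∀ i : Fin 6, (‖Mrel A w.1.1 w.1.2 w.2 i s‖ ≤ r * s ↔ ‖Lrel A w.1.1 w.1.2 w.2 i‖ ≤ r) :=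
    eventually_all.2 hrel
  -- the three balls
  have hb1 := eventually_lt_iff_of_ne (continuous_norm_dilate_param w.1.1) continuous_const (by simpa using hbx : (fun s : ℝ => ‖axPart w.1.1 + s • trPart w.1.1‖) 0 ≠ (fun _ : ℝ => (1:ℝ)) 0)
  have hb2 := eventually_lt_iff_of_ne (continuous_norm_dilate_param w.1.2) continuous_const (by simpa using hby : (fun s : ℝ => ‖axPart w.1.2 + s • trPart w.1.2‖) 0 ≠ (fun _ : ℝ => (1:ℝ)) 0)
  have hb3 := eventually_lt_iff_of_ne (continuous_norm_dilateIm_param w.2) continuous_const (by simpa using hbz : (fun s : ℝ => ‖(w.2.re : ℍ) + s • w.2.im‖) 0 ≠ (fun _ : ℝ => (1:ℝ)) 0)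
  filter_upwards [hall, hb1, hb2, hb3] with s hs h1 h2 h3
  simp only [zero_smul, add_zero] at h1 h2 h3
  rw [mem_rescaledSigmaR_iff, mem_limSigma_iff, dilate_eq_axPart_add, dilate_eq_axPart_add, dilateIm_eq_re_add, h1, h2, h3]
  constructor
  · rintro ⟨hM, hb, hbz'⟩
    exact ⟨fun i => (hs i).1 (hM i), hb, hbz', hz⟩
  · rintro ⟨hLi, hb, hbz', -⟩
    exact ⟨fun i => (hs i).2 (hLi i), hb, hbz'⟩

/-- **(case `z₀ < 0`)**: the first seam relation fails for all small `s > 0` (`‖M₃(s)‖ → 2`), so the rescaled event is eventually empty at `w`.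
[folklore] -/
theorem eventually_not_mem_rescaledSigmaR_of_neg {r : ℝ} {A : ℍ} (hA : ‖A‖ = 1) (hJ : A.imJ = 0) (hK : A.imK = 0) {w : (ℍ × ℍ) × ℍ}
    (hx : axPart w.1.1 ≠ 0) (hy : axPart w.1.2 ≠ 0) (hz : w.2.re < 0) :
    ∀ᶠ s in 𝓝[>] (0:ℝ), w ∉ rescaledSigmaR r s A := by
  have hc : ContinuousAt (Mrel A w.1.1 w.1.2 w.2 3) 0 := (hasDerivAt_Mrel A hx hy hz.ne 3).continuousAt
  have hn : Tendsto (fun s => ‖Mrel A w.1.1 w.1.2 w.2 3 s‖) (𝓝[>] (0:ℝ)) (𝓝 2) := by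
    have h := (hc.tendsto).norm
    rw [norm_Mrel_three_zero_of_neg hA hJ hK hx w.1.2 hz] at h
    exact h.mono_left nhdsWithin_le_nhds
  have hrs : Tendsto (fun s : ℝ => r * s) (𝓝[>] (0:ℝ)) (𝓝 0) := by
    have : Tendsto (fun s : ℝ => r * s) (𝓝 (0:ℝ)) (𝓝 (r * 0)) := (continuous_const.mul continuous_id).tendsto 0
    rw [mul_zero] at this
    exact this.mono_left nhdsWithin_le_nhds
  filter_upwards [hn.eventually (lt_mem_nhds (by norm_num : (1:ℝ) < 2)), hrs.eventually (gt_mem_nhds (by norm_num : (0:ℝ) < 1))]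
    with s h1 h2 hmem
  rw [mem_rescaledSigmaR_iff] at hmem
  have := hmem.1 3
  linarith

/-- ★★ **THE POINTWISE LIMIT OF THE INDICATORS**: at every `w = ((x,y),z)` with `x̄, ȳ ≠ 0`, `z₀ ≠ 0`, off the sphere pieces and off the level sets
`‖L_i‖ = r`, `𝟙_{rescaledSigmaR r s A}(w) → 𝟙_{limSigma r A}(w)` as `s → 0⁺`. [folklore] -/
theorem tendsto_indicator_rescaledSigmaR {r : ℝ} {A : ℍ} (hA : ‖A‖ = 1) (hJ : A.imJ = 0) (hK : A.imK = 0) {w : (ℍ × ℍ) × ℍ}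
    (hx : axPart w.1.1 ≠ 0) (hy : axPart w.1.2 ≠ 0) (hz : w.2.re ≠ 0)
    (hbx : ‖axPart w.1.1‖ ≠ 1) (hby : ‖axPart w.1.2‖ ≠ 1) (hbz : ‖(w.2.re : ℍ)‖ ≠ 1)
    (hL : ∀ i : Fin 6, ‖Lrel A w.1.1 w.1.2 w.2 i‖ ≠ r) :
    Tendsto (fun s => (rescaledSigmaR r s A).indicator (1 : (ℍ × ℍ) × ℍ → ℝ≥0∞) w) (𝓝[>] (0:ℝ))
      (𝓝 ((limSigma r A).indicator (1 : (ℍ × ℍ) × ℍ → ℝ≥0∞) w)) := by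
  refine (tendsto_congr' ?_).2 tendsto_const_nhds
  rcases lt_or_gt_of_ne hz with hneg | hpos
  · have hnot : w ∉ limSigma r A := fun h => absurd h.2.2.2 (not_lt.2 hneg.le)
    filter_upwards [eventually_not_mem_rescaledSigmaR_of_neg (r := r) hA hJ hK hx hy hneg] with s hs
    rw [Set.indicator_of_notMem hs, Set.indicator_of_notMem hnot]
  · filter_upwards [mem_rescaledSigmaR_eventually_iff hA hJ hK hx hy hpos hbx hby hbz hL] with s hs
    by_cases h : w ∈ limSigma r A
    · rw [Set.indicator_of_mem h, Set.indicator_of_mem (hs.2 h)]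
    · rw [Set.indicator_of_notMem h, Set.indicator_of_notMem (fun h' => h (hs.1 h'))]

/-! ## §30 Measurability of the derivatives in all variables -/

/-- `axPart` and `trPart` are continuous. [folklore] -/
theorem continuous_axPart_trPart : Continuous axPart ∧ Continuous trPart :=
  ⟨continuous_quat_mk Quaternion.continuous_re Quaternion.continuous_imI continuous_const continuous_const,
    continuous_quat_mk continuous_const continuous_const Quaternion.continuous_imJ Quaternion.continuous_imK⟩

/-- The fibrewise derivative of the unit radial field, `(x, v) ↦ (‖x‖⁻¹·P_x)(v)`, is jointly measurable. [folklore] -/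
theorem measurable_radialDeriv : Measurable fun p : ℍ × ℍ => (‖p.1‖⁻¹ • tangentialProj p.1) p.2 := by
  have e : (fun p : ℍ × ℍ => (‖p.1‖⁻¹ • tangentialProj p.1) p.2) =
      fun p => ‖p.1‖⁻¹ • (p.2 - ((‖p.1‖ ^ 2)⁻¹ * ⟪p.1, p.2⟫) • p.1) := by
    funext p; rw [show (‖p.1‖⁻¹ • tangentialProj p.1) p.2 = ‖p.1‖⁻¹ • tangentialProj p.1 p.2 from rfl, tangentialProj_apply]
  rw [e]
  have h1 : Measurable fun p : ℍ × ℍ => ‖p.1‖⁻¹ := (continuous_norm.comp continuous_fst).measurable.inv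
  have h2 : Measurable fun p : ℍ × ℍ => (‖p.1‖ ^ 2)⁻¹ * ⟪p.1, p.2⟫ :=
    ((continuous_norm.comp continuous_fst).measurable.pow_const 2).inv.mul (continuous_inner.measurable)
  exact h1.smul (measurable_snd.sub (h2.smul measurable_fst))

/-- `Xd` is measurable. [folklore] -/
theorem measurable_Xd : Measurable Xd := by
  have e : Xd = fun x => (fun p : ℍ × ℍ => (‖p.1‖⁻¹ • tangentialProj p.1) p.2) (axPart x, trPart x) := rfl
  rw [e]
  exact measurable_radialDeriv.comp (continuous_axPart_trPart.1.measurable.prodMk continuous_axPart_trPart.2.measurable)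

/-- `Zd` is measurable. [folklore] -/
theorem measurable_Zd : Measurable Zd := by
  have e : Zd = fun z => (fun p : ℍ × ℍ => (‖p.1‖⁻¹ • tangentialProj p.1) p.2) ((z.re : ℍ), z.im) := rfl
  rw [e]
  exact measurable_radialDeriv.comp ((Quaternion.continuous_coe.comp Quaternion.continuous_re).measurable.prodMk Quaternion.continuous_im.measurable)

/-- `x ↦ ν(x̄)` and `z ↦ ν(z₀)` are measurable. [folklore] -/
theorem measurable_radialUnit_axPart : Measurable (fun x : ℍ => radialUnit (axPart x)) ∧ Measurable (fun z : ℍ => radialUnit (z.re : ℍ)) :=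
  ⟨measurable_radialUnit.comp continuous_axPart_trPart.1.measurable,
    measurable_radialUnit.comp (Quaternion.continuous_coe.comp Quaternion.continuous_re).measurable⟩

/-- ★ **The derivatives `L_i` are jointly measurable in the hub and the three letters** (`A = radialUnit (axisPoint a)`). [folklore] -/
theorem measurable_Lrel_hub (i : Fin 6) :
    Measurable fun q : ℍ × ((ℍ × ℍ) × ℍ) => Lrel (radialUnit (axisPoint q.1)) q.2.1.1 q.2.1.2 q.2.2 i := by
  have hA : Measurable fun q : ℍ × ((ℍ × ℍ) × ℍ) => radialUnit (axisPoint q.1) := measurable_axisUnit.comp measurable_fst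
  have hsA : Measurable fun q : ℍ × ((ℍ × ℍ) × ℍ) => star (radialUnit (axisPoint q.1)) := continuous_star.measurable.comp hA
  have hx : Measurable fun q : ℍ × ((ℍ × ℍ) × ℍ) => q.2.1.1 := measurable_fst.comp (measurable_fst.comp measurable_snd)
  have hy : Measurable fun q : ℍ × ((ℍ × ℍ) × ℍ) => q.2.1.2 := measurable_snd.comp (measurable_fst.comp measurable_snd)
  have hz : Measurable fun q : ℍ × ((ℍ × ℍ) × ℍ) => q.2.2 := measurable_snd.comp measurable_snd
  have hXd : Measurable fun q : ℍ × ((ℍ × ℍ) × ℍ) => Xd q.2.1.1 := measurable_Xd.comp hx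
  have hYd : Measurable fun q : ℍ × ((ℍ × ℍ) × ℍ) => Xd q.2.1.2 := measurable_Xd.comp hy
  have hZd : Measurable fun q : ℍ × ((ℍ × ℍ) × ℍ) => Zd q.2.2 := measurable_Zd.comp hz
  have hux : Measurable fun q : ℍ × ((ℍ × ℍ) × ℍ) => radialUnit (axPart q.2.1.1) := measurable_radialUnit_axPart.1.comp hx
  have huy : Measurable fun q : ℍ × ((ℍ × ℍ) × ℍ) => radialUnit (axPart q.2.1.2) := measurable_radialUnit_axPart.1.comp hy
  have huz : Measurable fun q : ℍ × ((ℍ × ℍ) × ℍ) => radialUnit (q.2.2.re : ℍ) := measurable_radialUnit_axPart.2.comp hz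
  -- values and derivatives of the composite paths
  have hX0 : Measurable fun q : ℍ × ((ℍ × ℍ) × ℍ) => Xp q.2.1.1 0 := by simp only [Xp_zero]; exact hux
  have hY0 : Measurable fun q : ℍ × ((ℍ × ℍ) × ℍ) => Xp q.2.1.2 0 := by simp only [Xp_zero]; exact huy
  have hW0 : Measurable fun q : ℍ × ((ℍ × ℍ) × ℍ) => Wp (radialUnit (axisPoint q.1)) q.2.1.1 q.2.2 0 := by
    simp only [Wp_zero]; exact ((hsA.mul hux).mul hA).mul huz
  have hWd : Measurable fun q : ℍ × ((ℍ × ℍ) × ℍ) => Wd (radialUnit (axisPoint q.1)) q.2.1.1 q.2.2 := by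
    have e : (fun q : ℍ × ((ℍ × ℍ) × ℍ) => Wd (radialUnit (axisPoint q.1)) q.2.1.1 q.2.2) = fun q =>
        star (radialUnit (axisPoint q.1)) * Xd q.2.1.1 * radialUnit (axisPoint q.1) * radialUnit (q.2.2.re : ℍ) +
          star (radialUnit (axisPoint q.1)) * radialUnit (axPart q.2.1.1) * radialUnit (axisPoint q.1) * Zd q.2.2 := by
      funext q; rfl
    rw [e]
    exact (((hsA.mul hXd).mul hA).mul huz).add (((hsA.mul hux).mul hA).mul hZd)
  match i with
  | 0 =>
    show Measurable fun q : ℍ × ((ℍ × ℍ) × ℍ) => Xd q.2.1.1 * Wp (radialUnit (axisPoint q.1)) q.2.1.1 q.2.2 0 +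
      Xp q.2.1.1 0 * Wd (radialUnit (axisPoint q.1)) q.2.1.1 q.2.2 -
      (Wd (radialUnit (axisPoint q.1)) q.2.1.1 q.2.2 * Xp q.2.1.1 0 + Wp (radialUnit (axisPoint q.1)) q.2.1.1 q.2.2 0 * Xd q.2.1.1)
    exact ((hXd.mul hW0).add (hX0.mul hWd)).sub ((hWd.mul hX0).add (hW0.mul hXd))
  | 1 =>
    show Measurable fun q : ℍ × ((ℍ × ℍ) × ℍ) => Xd q.2.1.1 * Xp q.2.1.2 0 + Xp q.2.1.1 0 * Xd q.2.1.2 - (Xd q.2.1.2 * Xp q.2.1.1 0 + Xp q.2.1.2 0 * Xd q.2.1.1)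
    exact ((hXd.mul hY0).add (hX0.mul hYd)).sub ((hYd.mul hX0).add (hY0.mul hXd))
  | 2 =>
    show Measurable fun q : ℍ × ((ℍ × ℍ) × ℍ) => Wd (radialUnit (axisPoint q.1)) q.2.1.1 q.2.2 * Xp q.2.1.2 0 +
      Wp (radialUnit (axisPoint q.1)) q.2.1.1 q.2.2 0 * Xd q.2.1.2 -
      (Xd q.2.1.2 * Wp (radialUnit (axisPoint q.1)) q.2.1.1 q.2.2 0 + Xp q.2.1.2 0 * Wd (radialUnit (axisPoint q.1)) q.2.1.1 q.2.2)
    exact ((hWd.mul hY0).add (hW0.mul hYd)).sub ((hYd.mul hW0).add (hY0.mul hWd))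
  | 3 =>
    show Measurable fun q : ℍ × ((ℍ × ℍ) × ℍ) => radialUnit (axisPoint q.1) * Wd (radialUnit (axisPoint q.1)) q.2.1.1 q.2.2 -
      Xd q.2.1.1 * radialUnit (axisPoint q.1)
    exact (hA.mul hWd).sub (hXd.mul hA)
  | 4 =>
    show Measurable fun q : ℍ × ((ℍ × ℍ) × ℍ) => radialUnit (axisPoint q.1) * Xd q.2.1.1 - Wd (radialUnit (axisPoint q.1)) q.2.1.1 q.2.2 * radialUnit (axisPoint q.1)
    exact (hA.mul hXd).sub (hWd.mul hA)
  | 5 =>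
    show Measurable fun q : ℍ × ((ℍ × ℍ) × ℍ) => radialUnit (axisPoint q.1) * Xd q.2.1.2 - Xd q.2.1.2 * radialUnit (axisPoint q.1)
    exact (hA.mul hYd).sub (hYd.mul hA)

/-- ★ The limit event is jointly measurable in the hub and the letters. [folklore] -/
theorem measurableSet_limSigma_hub (r : ℝ) :
    MeasurableSet {q : ℍ × ((ℍ × ℍ) × ℍ) | q.2 ∈ limSigma r (radialUnit (axisPoint q.1))} := by
  have hx : Measurable fun q : ℍ × ((ℍ × ℍ) × ℍ) => q.2.1.1 := measurable_fst.comp (measurable_fst.comp measurable_snd)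
  have hy : Measurable fun q : ℍ × ((ℍ × ℍ) × ℍ) => q.2.1.2 := measurable_snd.comp (measurable_fst.comp measurable_snd)
  have hz : Measurable fun q : ℍ × ((ℍ × ℍ) × ℍ) => q.2.2 := measurable_snd.comp measurable_snd
  have h1 : MeasurableSet {q : ℍ × ((ℍ × ℍ) × ℍ) | ∀ i : Fin 6, ‖Lrel (radialUnit (axisPoint q.1)) q.2.1.1 q.2.1.2 q.2.2 i‖ ≤ r} := by
    rw [Set.setOf_forall]
    exact MeasurableSet.iInter fun i => measurableSet_le (measurable_Lrel_hub i).norm measurable_const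
  have h2 : MeasurableSet {q : ℍ × ((ℍ × ℍ) × ℍ) | ‖axPart q.2.1.1‖ < 1} :=
    measurableSet_lt (continuous_axPart_trPart.1.measurable.comp hx).norm measurable_const
  have h3 : MeasurableSet {q : ℍ × ((ℍ × ℍ) × ℍ) | ‖axPart q.2.1.2‖ < 1} :=
    measurableSet_lt (continuous_axPart_trPart.1.measurable.comp hy).norm measurable_const
  have h4 : MeasurableSet {q : ℍ × ((ℍ × ℍ) × ℍ) | ‖(q.2.2.re : ℍ)‖ < 1} :=
    measurableSet_lt ((Quaternion.continuous_coe.comp Quaternion.continuous_re).measurable.comp hz).norm measurable_const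
  have h5 : MeasurableSet {q : ℍ × ((ℍ × ℍ) × ℍ) | 0 < q.2.2.re} := measurableSet_lt measurable_const (Quaternion.continuous_re.measurable.comp hz)
  have e : {q : ℍ × ((ℍ × ℍ) × ℍ) | q.2 ∈ limSigma r (radialUnit (axisPoint q.1))} =
      {q | ∀ i : Fin 6, ‖Lrel (radialUnit (axisPoint q.1)) q.2.1.1 q.2.1.2 q.2.2 i‖ ≤ r} ∩ (({q | ‖axPart q.2.1.1‖ < 1} ∩ {q | ‖axPart q.2.1.2‖ < 1}) ∩
        ({q | ‖(q.2.2.re : ℍ)‖ < 1} ∩ {q | 0 < q.2.2.re})) := by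
    ext q; simp only [Set.mem_setOf_eq, mem_limSigma_iff, Set.mem_inter_iff]
  rw [e]
  exact h1.inter ((h2.inter h3).inter (h4.inter h5))

end Summit.QuantumFields.YangMills.Theorems.SwapVirialDeficit.ZeroModeSigma

end
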